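import Mathlib
import HarnessLib
import Summits.QuantumAdvantage.QuantumAdvantage.Theorems.SyndeticDialC

/-!
# SyndeticDial, part D (§7 the TWO-CUT LOCUS: free two-tier window law, the two-cut strategy, the kernel no-go `not_twoTier_half_of_qAt`, the floor-conditioned split `closesF`) — support for item stmt-QuantumAdvantage-28401

Cell decomp-qadv, seat lens-5 («finite range + asymptotic regime + bridge»), generation 27 — land port of §7 of the node
«SyndeticDial» (HOME/decomp-qadv-lens-5/g27/SyndeticDial.lean, record NODE-g27.md N6; RESIDUAL MODE on AbsorptionDial:28401
`MassHiQuasi`).  Parts A (§1–§2 window/extension laws), B (§3–§5 the gap dial, polylog kernels, `closes_dial`) and C (§5b link to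
g26) are IN THE TREE (p819709 / p819783 / p819944); this part D is the node's §7 with ONLY the namespace renamed
`Theses.SyndeticDial → Theorems.SyndeticDial`: the TWO-CUT LOCUS of the length barrier — `windowAbsorb_tail` /
`hasDegF_windowAbsorb_tail` (the absorbed window strategy equals the plain restriction at every cut ≥ 2: the window law's whole
degree cost sits on cuts 0, 1), two-tier hardness `HardR₂` and the FREE window law `hardR_of_window₂`, the two-tier robustness
statement `TwoTier p f` with `gapLaw_of_twoTier` / `twoTier_polylog`, the TWO-CUT STRATEGY `twoCut` (MOD₃-of-weight masks on cuts
0, 1; wins at every input, `ringWinU_twoCut`, from the tree's `ExactHit.lit_zero_or_one`), `not_hardR₂_top` / `not_hardR₂_of_le`,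
the scale change `hardAt_of_qAt`, the KERNEL NO-GO `not_twoTier_half_of_qAt : QAt p → ¬ TwoTier p half` (given Q, no bridge
factoring through window absorption reaches n/2), `not_twoTierPiece_half_of_quasiLoss`, `twoTierPiece_half_inconsistent :
QuarterFloor → SyndPiece half → TwoTierPiece half → False`, and the FLOOR-CONDITIONED bridge `GapPieceF` (T-implied,
`gapPieceF_of_massHiQuasi`) with `closes_floor` / `closesF : SyndPiece half → GapPieceF half → Theses.AbsorptionDial.MassHiQuasi`.
Tree facts reused by name: `AbsorptionDial.windowAbsorb/absorb/inStrategy/hasDegF_inStrategy/hasDegF_windowAbsorb/two_mul_pow_le_two_pow`,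
`RegisterRotation.xorStrat/ringWinU_xorStrat`, `ExactHit.oneCut/lit/ringWinU_oneCut/lit_zero_or_one`, `hasDegF_of_junta`,
`RigidityLaws.hasDegF_const`, `LengthDial.HardR/hardR_mono/hasDegF_mono/QuasiLoss/QuarterFloor/massHiQuasi_unfold`, and from the landed
parts `winCount_window`, `prefix_schedule`, `HardAt/QAt/GapLaw/SyndPiece/GapPiece/half/plog/closes_dial/gapPiece_of_quasiLoss/
quasiLoss_iff_qAt/qAt_of_synd_gapLaw/one_le_of_hardR_zero`.  No `sorry`, no new axioms, no instances, no notation.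
-/

set_option autoImplicit false
set_option linter.dupNamespace false

namespace Summit.QuantumAdvantage.QuantumAdvantage.Theorems.SyndeticDial
open Finset
open Summit.QuantumAdvantage.AdviceFreeQNC0
open Literature.Computability.MetaComplexity Literature.Computability.MetaComplexity.Smolensky
open Summit.QuantumAdvantage.QuantumAdvantage.Theorems.LengthDial
open Summit.QuantumAdvantage.QuantumAdvantage.Theorems.AbsorptionDial

/-! ## §7 THE TWO-CUT LOCUS of the barrier: the window law is FREE in degree at every cut except cuts `0` and `1`,
and cuts `0`, `1` with MOD₃ power win the game outright -/

section TwoCut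

variable {k ℓ q : ℕ} (c : ℕ) (y : Fin (k + ℓ + q + 1) → (Fin (k + ℓ + q) → Bool) → Bool)
variable {p : ℕ} [Fact p.Prime]

/-- **where the degree cost lives**: the absorbed window strategy AGREES with the plain restriction `inStrategy` at
every cut `g ≥ 2` (the tree's `absorb` touches cuts `0` and `1` only), so those cuts keep degree `d`. -/
theorem windowAbsorb_tail (a : Fin k → Bool) (b : Fin q → Bool) (g : Fin (ℓ + 1)) (hg : 2 ≤ g.val) :
    windowAbsorb c y a b g = inStrategy y a b g := by
  funext w
  unfold windowAbsorb RegisterRotation.xorStrat absorb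
  have h0 : g.val ≠ 0 := by omega
  have h1 : g.val ≠ 1 := by omega
  simp [h0, h1]

/-- cuts `g ≥ 2` of the absorbed window strategy have the ORIGINAL degree `d` (no cost). -/
theorem hasDegF_windowAbsorb_tail {d : ℕ} (hy : ∀ g, HasDegF p (y g) d) (a : Fin k → Bool) (b : Fin q → Bool)
    (g : Fin (ℓ + 1)) (hg : 2 ≤ g.val) : HasDegF p (windowAbsorb c y a b g) d := by
  rw [windowAbsorb_tail c y a b g hg]
  exact hasDegF_inStrategy y hy a b g

/-- **two-tier hardness**: value `≤ θ` against strategies whose cuts `g ≥ 2` have degree `≤ d` and whose cuts `0`, `1`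
have degree `≤ D` (`HardR p m d θ = HardR₂ p m d d θ` up to monotonicity). -/
def HardR₂ (p : ℕ) [Fact p.Prime] (m d D : ℕ) (θ : ℝ) : Prop :=
  ∀ (c : ℕ) (y : Fin (m + 1) → (Fin m → Bool) → Bool), (∀ g, 2 ≤ g.val → HasDegF p (y g) d) →
    (∀ g, g.val < 2 → HasDegF p (y g) D) → (winCount m c y : ℝ) ≤ θ * 2 ^ m

/-- two-tier hardness gives plain hardness at the lower degree. -/
theorem hardR_of_hardR₂ {m d D : ℕ} {θ : ℝ} (h : HardR₂ p m d D θ) (hdD : d ≤ D) : HardR p m d θ :=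
  fun c y hy => h c y (fun g _ => hy g) fun g _ => hasDegF_mono (hy g) hdD

/-- plain hardness at the higher degree gives two-tier hardness. -/
theorem hardR₂_of_hardR {m d D : ℕ} {θ : ℝ} (h : HardR p m D θ) (hdD : d ≤ D) : HardR₂ p m d D θ :=
  fun c y hy hY => h c y fun g => by
    rcases Nat.lt_or_ge g.val 2 with hg | hg
    · exact hY g hg
    · exact hasDegF_mono (hy g hg) hdD

/-- two-tier hardness is antitone in the top-tier degree (a smaller class of strategies is easier to be hard against). -/
theorem hardR₂_anti {m d D D' : ℕ} {θ : ℝ} (h : HardR₂ p m d D θ) (hD : D' ≤ D) : HardR₂ p m d D' θ :=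
  fun c y hy hY => h c y hy fun g hg => hasDegF_mono (hY g hg) hD

/-- two-tier hardness is antitone in the interior degree as well. -/
theorem hardR₂_anti_low {m d d' D : ℕ} {θ : ℝ} (h : HardR₂ p m d D θ) (hd : d' ≤ d) : HardR₂ p m d' D θ :=
  fun c y hy hY => h c y (fun g hg => hasDegF_mono (hy g hg) hd) hY

/-- **THE FREE WINDOW LAW (two-tier form)**: hardness at length `ℓ ≥ 1` against strategies with cuts `≥ 2` of degree
`d` and cuts `0, 1` of degree `d + 2(k+q)d + 1` gives hardness at length `k + ℓ + q` against UNIFORM degree `d`.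
The whole degree cost of `hardR_of_window` is the XOR-merging of the `k + q` frozen outside cuts into cuts `0` and `1`. -/
theorem hardR_of_window₂ {d : ℕ} {θ : ℝ} (hℓ : 1 ≤ ℓ) (h : HardR₂ p ℓ d (d + (2 * ((k + q) * d) + 1)) θ) :
    HardR p (k + ℓ + q) d θ := by
  intro c y hy
  rw [winCount_window c y hℓ]
  push_cast
  have hterm : ∀ (a : Fin k → Bool) (b : Fin q → Bool),
      (winCount ℓ (inCharge c a b) (windowAbsorb c y a b) : ℝ) ≤ θ * 2 ^ ℓ := fun a b =>
    h _ _ (fun g hg => hasDegF_windowAbsorb_tail c y hy a b g hg) fun g _ => hasDegF_windowAbsorb c y hy a b g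
  calc ∑ a : Fin k → Bool, ∑ b : Fin q → Bool, (winCount ℓ (inCharge c a b) (windowAbsorb c y a b) : ℝ)
      ≤ ∑ a : Fin k → Bool, ∑ b : Fin q → Bool, θ * 2 ^ ℓ :=
        Finset.sum_le_sum fun a _ => Finset.sum_le_sum fun b _ => hterm a b
    _ = θ * 2 ^ (k + ℓ + q) := by
        rw [Finset.sum_const, Finset.sum_const, Finset.card_univ, Finset.card_univ, Fintype.card_fun,
          Fintype.card_fun, Fintype.card_bool, Fintype.card_fin, Fintype.card_fin]
        simp only [nsmul_eq_mul]
        push_cast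
        ring

/-- prefix form of the free law (`q = 0`). -/
theorem hardR_of_prefix₂ {d : ℕ} {θ : ℝ} (hℓ : 1 ≤ ℓ) (h : HardR₂ p ℓ d (d + (2 * (k * d) + 1)) θ) :
    HardR p (k + ℓ) d θ := by
  have hw := hardR_of_window₂ (k := k) (q := 0) (p := p) hℓ (by simpa using h)
  simpa using hw

end TwoCut

section TwoCutDefeat

variable {m : ℕ}

/-- **the two-cut strategy**: cut `0` selects the inputs where its own character is live, cut `1` selects the others
(where, by the tree's `ExactHit.lit_zero_or_one`, cut `1`'s character is live); every other cut is silent. -/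
def twoCut (c : ℕ) : Fin (m + 1 + 1) → (Fin (m + 1) → Bool) → Bool :=
  RegisterRotation.xorStrat (ExactHit.oneCut 0 (ExactHit.lit c 0)) (ExactHit.oneCut 1 fun u => !ExactHit.lit c 0 u)

/-- **TWO CUTS WITH MOD₃ POWER WIN OUTRIGHT**: the two-cut strategy wins the length-`(m+1)` game at EVERY input and
every charge.  The masks are MOD₃ functions of the weight — exactly the power that XOR-merging `≈ m` frozen outside
cuts confers on cuts `0`, `1`; so two-tier hardness FAILS at the top tier (`not_hardR₂_top`) and the length gap of any
absorption bridge is bounded by the MOD₃-approximation degree at two cuts (module docstring §B'). -/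
theorem ringWinU_twoCut (c : ℕ) (u : Fin (m + 1) → Bool) : ringWinU c (twoCut c) u = true := by
  unfold twoCut
  rw [RegisterRotation.ringWinU_xorStrat, ExactHit.ringWinU_oneCut, ExactHit.ringWinU_oneCut]
  rcases ExactHit.lit_zero_or_one c u with h0 | h1
  · simp [h0]
  · cases h : ExactHit.lit c 0 u
    · simpa [h] using h1
    · simp [h]

/-- the two-cut strategy wins all `2^(m+1)` inputs. -/
theorem winCount_twoCut (c : ℕ) : winCount (m + 1) c (twoCut c) = 2 ^ (m + 1) := by
  unfold winCount
  rw [Finset.filter_true_of_mem fun u _ => ringWinU_twoCut c u, Finset.card_univ, Fintype.card_fun,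
    Fintype.card_bool, Fintype.card_fin]

variable {p : ℕ} [Fact p.Prime]

/-- every cut of the two-cut strategy has degree `≤ m + 1` (cuts `≥ 2` are constant, degree `0`). -/
theorem hasDegF_twoCut (c : ℕ) (g : Fin (m + 1 + 1)) : HasDegF p (twoCut (m := m) c g) (m + 1) := by
  have hJ := hasDegF_of_junta (p := p) (Finset.univ : Finset (Fin (m + 1))) (twoCut (m := m) c g)
    (fun u v huv => by rw [show u = v from funext fun i => huv i (Finset.mem_univ i)])
  simpa using hJ

/-- cuts `g ≥ 2` of the two-cut strategy are silent (degree `0`). -/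
theorem hasDegF_twoCut_tail (c : ℕ) (g : Fin (m + 1 + 1)) (hg : 2 ≤ g.val) : HasDegF p (twoCut (m := m) c g) 0 := by
  have : twoCut (m := m) c g = fun _ => false := by
    funext u
    unfold twoCut RegisterRotation.xorStrat ExactHit.oneCut
    have h0 : g ≠ 0 := fun h => by rw [h] at hg; simp at hg
    have h1 : g ≠ 1 := fun h => by
      rw [h] at hg
      simp at hg
    simp [h0, h1]
  rw [this]
  exact RigidityLaws.hasDegF_const p false 0

/-- **KERNEL RUNG OF THE CEILING**: two-tier hardness with top tier of FULL degree is FALSE at interior degree `0` —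
at every length `m + 1`, every prime and every `θ < 1`. -/
theorem not_hardR₂_top {θ : ℝ} (hθ : θ < 1) : ¬ HardR₂ p (m + 1) 0 (m + 1) θ := by
  intro h
  have hw := h 0 (twoCut 0) (fun g hg => hasDegF_twoCut_tail 0 g hg) fun g _ => hasDegF_twoCut 0 g
  rw [winCount_twoCut] at hw
  push_cast at hw
  have h2 : (0 : ℝ) < 2 ^ (m + 1) := by positivity
  nlinarith

/-- hence two-tier hardness is false as soon as the top tier reaches the number of bits (any interior degree). -/
theorem not_hardR₂_of_le {d D : ℕ} {θ : ℝ} (hθ : θ < 1) (hD : m + 1 ≤ D) : ¬ HardR₂ p (m + 1) d D θ :=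
  fun h => not_hardR₂_top hθ (hardR₂_anti (hardR₂_anti_low h (Nat.zero_le d)) hD)

end TwoCutDefeat

section TwoTierDial

variable (p : ℕ) [Fact p.Prime]

/-- **TWO-TIER ROBUSTNESS of reach `f`** (the statement every absorption bridge needs, §B'): hardness at scale `n` of
a length `m ∈ [n − f n, n]` against UNIFORM polylog degree implies hardness against strategies whose cuts `0`, `1`
have the LARGER degree `L^C·(2(n − m) + 1) + 1` the free window law charges. -/
def TwoTier (f : ℕ → ℕ) : Prop :=
  ∀ A : ℕ, ∃ A' : ℕ, ∀ C : ℕ, ∃ C' : ℕ, ∃ n₀ : ℕ, ∀ n ≥ n₀, ∀ m : ℕ, n - f n ≤ m → m ≤ n →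
    HardAt p A C' n m →
      HardR₂ p m ((Nat.log 2 n) ^ C) ((Nat.log 2 n) ^ C + (2 * ((n - m) * (Nat.log 2 n) ^ C) + 1))
        (1 - 1 / (2 : ℝ) ^ ((Nat.log 2 n) ^ A'))

variable {p}

/-- **the gap law of reach `f` follows from two-tier robustness of reach `f`** (free window law; `m = 0` excluded by
`one_le_of_hardR_zero` as in §5b). -/
theorem gapLaw_of_twoTier {f : ℕ → ℕ} (h : TwoTier p f) : GapLaw p f := by
  intro A
  obtain ⟨A', hA'⟩ := h A
  refine ⟨A', fun C => ?_⟩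
  obtain ⟨C', n₀, hn₀⟩ := hA' C
  refine ⟨C', n₀, fun n hn m hnm hmn hm => ?_⟩
  have h2 := hn₀ n hn m hnm hmn hm
  unfold HardAt at hm ⊢
  have hθ : (1 : ℝ) - 1 / (2 : ℝ) ^ ((Nat.log 2 n) ^ A) < 1 := by
    have : (0 : ℝ) < 1 / (2 : ℝ) ^ ((Nat.log 2 n) ^ A) := by positivity
    linarith
  rcases Nat.eq_zero_or_pos m with rfl | hm1
  · exact absurd (one_le_of_hardR_zero hm) (not_le.mpr hθ)
  · obtain ⟨k, rfl⟩ : ∃ k, n = k + m := ⟨n - m, by omega⟩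
    have hk : k + m - m = k := by omega
    rw [hk] at h2
    exact hardR_of_prefix₂ hm1 h2

/-- two-tier robustness at POLYLOG reach is PROVED (degree absorption: `L^C(2L^B + 1) + 1 ≤ L^(B+C+2)`), recovering
`gapLaw_polylog`. -/
theorem twoTier_polylog (B : ℕ) : TwoTier p fun n => (Nat.log 2 n) ^ B := by
  intro A
  refine ⟨A, fun C => ⟨B + C + 2, ?_⟩⟩
  obtain ⟨L₀, hL₀⟩ := two_mul_pow_le_two_pow B
  refine ⟨2 ^ (max L₀ 2), fun n hn m hnm hmn hm => ?_⟩
  have hnm' : n - (Nat.log 2 n) ^ B ≤ m := hnm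
  unfold HardAt at hm
  have hn0 : n ≠ 0 := by
    have := Nat.one_le_two_pow (n := max L₀ 2); omega
  have hLge : max L₀ 2 ≤ Nat.log 2 n := Nat.le_log_of_pow_le one_lt_two hn
  have hL2 : 2 ≤ Nat.log 2 n := le_trans (le_max_right _ _) hLge
  have hkB : n - m ≤ (Nat.log 2 n) ^ B := by omega
  have hCle : (Nat.log 2 n) ^ C ≤ (Nat.log 2 n) ^ (B + C + 2) := Nat.pow_le_pow_right (by omega) (by omega)
  exact hardR₂_anti (hardR₂_of_hardR hm hCle) (prefix_schedule hL2 hkB)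

/-- hardness is monotone in the value bound. -/
theorem hardR_mono_theta {m D : ℕ} {θ θ' : ℝ} (h : HardR p m D θ) (hθ : θ ≤ θ') : HardR p m D θ' :=
  fun c y hy => le_trans (h c y hy) (mul_le_mul_of_nonneg_right hθ (by positivity))

/-- **SCALE CHANGE**: Q at `p` makes every length `m ∈ [n − n/2, n]` hard AT SCALE `n`, for every `C`
(`(log₂ n)^C ≤ (log₂ m)^{2C}` and `2^{−(log₂ n)^A} ≤ 2^{−(log₂ m)^A}` once `n ≥ 16`). -/
theorem hardAt_of_qAt (hQ : QAt p) :
    ∃ A : ℕ, ∀ C : ℕ, ∃ n₀ : ℕ, ∀ n ≥ n₀, ∀ m : ℕ, n - n / 2 ≤ m → m ≤ n → HardAt p A C n m := by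
  obtain ⟨A, hA⟩ := hQ
  refine ⟨A, fun C => ?_⟩
  obtain ⟨n₀, hn₀⟩ := hA (2 * C)
  refine ⟨max (2 * n₀) 16, fun n hn m hnm hmn => ?_⟩
  have hm₀ : n₀ ≤ m := by omega
  have hm := hn₀ m hm₀
  unfold HardAt at hm ⊢
  have hn16 : 16 ≤ n := le_trans (le_max_right _ _) hn
  have hL4 : 4 ≤ Nat.log 2 n := Nat.le_log_of_pow_le one_lt_two (by norm_num; omega)
  have hm0 : m ≠ 0 := by omega
  have hlogm : Nat.log 2 n - 1 ≤ Nat.log 2 m := by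
    have h1 : Nat.log 2 (n / 2) = Nat.log 2 n - 1 := Nat.log_div_base 2 n
    have h2 : Nat.log 2 (n / 2) ≤ Nat.log 2 m := Nat.log_mono_right (by omega)
    omega
  have hdeg : (Nat.log 2 n) ^ C ≤ (Nat.log 2 m) ^ (2 * C) := by
    have hsq : Nat.log 2 n ≤ (Nat.log 2 n - 1) ^ 2 := by
      obtain ⟨L, hL⟩ : ∃ L, Nat.log 2 n = L + 4 := ⟨Nat.log 2 n - 4, by omega⟩
      rw [hL, show L + 4 - 1 = L + 3 by omega]
      nlinarith
    calc (Nat.log 2 n) ^ C ≤ ((Nat.log 2 n - 1) ^ 2) ^ C := Nat.pow_le_pow_left hsq C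
      _ = (Nat.log 2 n - 1) ^ (2 * C) := by rw [← pow_mul]
      _ ≤ (Nat.log 2 m) ^ (2 * C) := Nat.pow_le_pow_left hlogm _
  have hval : (1 : ℝ) - 1 / (2 : ℝ) ^ ((Nat.log 2 m) ^ A) ≤ 1 - 1 / (2 : ℝ) ^ ((Nat.log 2 n) ^ A) := by
    have hle : (Nat.log 2 m) ^ A ≤ (Nat.log 2 n) ^ A := Nat.pow_le_pow_left (Nat.log_mono_right hmn) A
    have hpow : (2 : ℝ) ^ ((Nat.log 2 m) ^ A) ≤ (2 : ℝ) ^ ((Nat.log 2 n) ^ A) :=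
      pow_le_pow_right₀ (by norm_num) hle
    have := one_div_le_one_div_of_le (by positivity) hpow
    linarith
  exact hardR_mono_theta (hardR_mono hm hdeg) hval

/-- **KERNEL NO-GO — THE ABSORPTION BRIDGE OF REACH `n/2` IS FALSE GIVEN Q.**  Two-tier robustness of reach `half`
charges cuts `0`, `1` of the length `m = n − n/2` a degree `≥ 2·(n/2) + 2 > m`, i.e. lets them be ARBITRARY; the two-cut
strategy (`ringWinU_twoCut`) then wins outright, contradicting the hardness of `m` at scale `n` that Q supplies
(`hardAt_of_qAt`).  So no bridge factoring through window absorption reaches `n/2` (nor any reach `f` with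
`2·f(n)·(log₂ n)^C ≥ n − f(n)`); the reach ceiling of the mechanism is discussed in the module docstring §B'. -/
theorem not_twoTier_half_of_qAt (hQ : QAt p) : ¬ TwoTier p half := by
  intro hT
  obtain ⟨A, hA⟩ := hardAt_of_qAt hQ
  obtain ⟨A', hA'⟩ := hT A
  obtain ⟨C', n₀, hn₀⟩ := hA' 0
  obtain ⟨n₁, hn₁⟩ := hA C'
  have hθ : (1 : ℝ) - 1 / (2 : ℝ) ^ ((Nat.log 2 (max (max n₀ n₁) 2)) ^ A') < 1 := by
    have : (0 : ℝ) < 1 / (2 : ℝ) ^ ((Nat.log 2 (max (max n₀ n₁) 2)) ^ A') := by positivity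
    linarith
  set n := max (max n₀ n₁) 2 with hn
  have hn2 : 2 ≤ n := le_max_right _ _
  have hn₀' : n₀ ≤ n := le_trans (le_max_left _ _) (le_max_left _ _)
  have hn₁' : n₁ ≤ n := le_trans (le_max_right _ _) (le_max_left _ _)
  have hm := hn₁ n hn₁' (n - n / 2) le_rfl (Nat.sub_le _ _)
  have h2 := hn₀ n hn₀' (n - n / 2) le_rfl (Nat.sub_le _ _) hm
  obtain ⟨m', hm'⟩ : ∃ m', n - n / 2 = m' + 1 := ⟨n - n / 2 - 1, by omega⟩
  have hgap : n - (n - n / 2) = n / 2 := by omega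
  rw [hgap, hm'] at h2
  simp only [pow_zero, Nat.mul_one] at h2
  exact not_hardR₂_of_le hθ (by omega) h2

end TwoTierDial

section TwoTierPieces

/-- global two-tier robustness piece of reach `f`. -/
def TwoTierPiece (f : ℕ → ℕ) : Prop := ∀ (p : ℕ) [Fact p.Prime], 5 ≤ p → TwoTier p f

/-- the bridge at reach `f` follows from the two-tier piece at reach `f`. -/
theorem gapPiece_of_twoTierPiece (f : ℕ → ℕ) (h : TwoTierPiece f) : GapPiece f :=
  fun p _ hp => gapLaw_of_twoTier (h p hp)

/-- the two-tier piece at polylog reach is PROVED. -/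
theorem twoTierPiece_polylog (B : ℕ) : TwoTierPiece (plog B) := fun _ _ _ => twoTier_polylog B

/-- `closes` through the two-tier piece: `SyndPiece f → TwoTierPiece f → MassHiQuasi`. -/
theorem closes_twoTier (f : ℕ → ℕ) (hS : SyndPiece f) (hT : TwoTierPiece f) :
    Summit.QuantumAdvantage.QuantumAdvantage.Theses.AbsorptionDial.MassHiQuasi :=
  closes_dial f hS (gapPiece_of_twoTierPiece f hT)

/-- **the two-tier piece of reach `n/2` is REFUTED by Q** (hence by the target under the floor). -/
theorem not_twoTierPiece_half_of_quasiLoss (hQ : QuasiLoss) : ¬ TwoTierPiece half := fun hT =>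
  haveI : Fact (Nat.Prime 5) := ⟨by norm_num⟩
  not_twoTier_half_of_qAt (quasiLoss_iff_qAt.1 hQ 5 le_rfl) (hT 5 le_rfl)

/-- **THE ABSORPTION-FACTORED SPLIT AT REACH `n/2` IS VACUOUS** (kernel): under the quarter floor its two premises are
jointly inconsistent — together they give Q (`closes_twoTier`), and Q refutes the two-tier piece.  This is the
certified answer to «is there an absorption-type mechanism for the reach-`n/2` bridge?»: no. -/
theorem twoTierPiece_half_inconsistent (hF : QuarterFloor) (hS : SyndPiece half) (hT : TwoTierPiece half) : False :=
  not_twoTierPiece_half_of_quasiLoss (massHiQuasi_unfold.1 (closes_twoTier half hS hT) hF) hT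

end TwoTierPieces

section Floor

/-- **the FLOOR-CONDITIONED bridge** (critic 74v23's costless repair): `GapPieceF f := QuarterFloor → GapPiece f` —
T-implied (`gapPieceF_of_massHiQuasi`), hence WEAKER than the target like `SyndPiece f`, and still closing. -/
def GapPieceF (f : ℕ → ℕ) : Prop := QuarterFloor → GapPiece f

/-- the floor-conditioned bridge is T-implied (T gives Q under the floor, and Q gives every gap law). -/
theorem gapPieceF_of_massHiQuasi (f : ℕ → ℕ)
    (h : Summit.QuantumAdvantage.QuantumAdvantage.Theses.AbsorptionDial.MassHiQuasi) : GapPieceF f :=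
  fun hF => gapPiece_of_quasiLoss f (massHiQuasi_unfold.1 h hF)

/-- the unconditioned bridge gives the conditioned one. -/
theorem gapPieceF_of_gapPiece (f : ℕ → ℕ) (h : GapPiece f) : GapPieceF f := fun _ => h

/-- **`closes_floor : SyndPiece f → GapPieceF f → MassHiQuasi`** — both pieces T-implied. -/
theorem closes_floor (f : ℕ → ℕ) (hS : SyndPiece f) (hG : GapPieceF f) :
    Summit.QuantumAdvantage.QuantumAdvantage.Theses.AbsorptionDial.MassHiQuasi :=
  massHiQuasi_unfold.2 fun hF =>
    (quasiLoss_iff_qAt).2 fun p _ hp => qAt_of_synd_gapLaw (hS hF p hp) (hG hF p hp)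

/-- the reach-`n/2` split with BOTH pieces WEAKER: `closesF : SyndPiece half → GapPieceF half → MassHiQuasi`. -/
theorem closesF (hS : SyndPiece half) (hG : GapPieceF half) :
    Summit.QuantumAdvantage.QuantumAdvantage.Theses.AbsorptionDial.MassHiQuasi :=
  closes_floor half hS hG

end Floor

end Summit.QuantumAdvantage.QuantumAdvantage.Theorems.SyndeticDial
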